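import Summits.AtomisticToContinuum.BoseEinsteinCondensation.Theorems.BECThomsonPrincipleGDTransferSeededCompactClosed
import Summits.AtomisticToContinuum.BoseEinsteinCondensation.Theorems.BECThomsonPrincipleGDTransferSeededSmoothBlockAlgebra
import Summits.AtomisticToContinuum.BoseEinsteinCondensation.Theorems.BECThomsonPrincipleGDTransferSeededSmoothSplitting
import Summits.AtomisticToContinuum.BoseEinsteinCondensation.Theorems.BECThomsonPrincipleGDTransferSeededPinchingBound
import Summits.AtomisticToContinuum.BoseEinsteinCondensation.Theorems.BECThomsonPrincipleGDTransferSeededCatKyFan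
import Summits.AtomisticToContinuum.BoseEinsteinCondensation.Theorems.BECThomsonPrincipleGDTransferSeededSpectralSeed
import Summits.AtomisticToContinuum.BoseEinsteinCondensation.Theorems.BECThomsonPrincipleGDTransferSeededIvtGlueFor
import Summits.AtomisticToContinuum.BoseEinsteinCondensation.Theorems.BECThomsonPrincipleGDTransferSeededProjectedDichotomyClosed
import Summits.AtomisticToContinuum.BoseEinsteinCondensation.Theorems.BECThomsonPrincipleGDTransferSeededLocalConstancy
import Summits.AtomisticToContinuum.BoseEinsteinCondensation.Theorems.BECThomsonPrincipleGDTransferSeededFreeCorner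

/-!
# Route `BECThomsonPrinciple`, crux `GDTransfer` (stmt-AtomisticToContinuum-9482), line `seeded-continuity` —
# the SPECTRAL SEED programme CLOSED (lead c4): Gaussian domination + a Ky Fan gap floor ⇒ periodic BEC

Supports (does not close) stmt-AtomisticToContinuum-9482.  Composition of the spectral-seed programme (Defs `…SeededSpectralDefs`
p164024): its four analytic sub-goals are LANDED — `smoothBlockAlgebra` (p164591), `smoothSplitting`, `pinchingBound`, `catKyFan` —
and so is the assembly `seedFor_of_kyFanGapFloor` and the per-potential connectedness assembly `ivtGlue_for` (p164701).  Hence: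

* `noBalancedCatFor_of_kyFanGapFloor` — **the seed at a finite continuous potential follows from a Ky Fan gap floor `K/L³` on the
  dilute path** (quantitative cat exclusion: a `τ`-balanced `δ`-near-minimiser forces `kyFanTwo − 2E₀ ≤ (8/τ²)(δ + O(‖v‖₁/((1−β−θ)²L³)))`,
  uniformly in `N`, by the smooth IMS cut in the `n̂₀`-grading — Gaussian domination and band emptiness unused);
* `periodicBEC_of_gd_of_kyFanGapFloor` — **Gaussian domination (T = 0 phase stiffness, the route's crux `GaussianDominationCan`) and a Ky Fan
  gap floor `K/L³` on the dilute path together imply periodic Bose–Einstein condensation for every admissible finite continuous pair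
  potential** — an honest conditional theorem with two standard physical hypotheses (registered glue of this programme);
* `gdTransfer_of_kyFanGapFloor_of_rest` — the crux from the gap floors (finite continuous class), the seed on the remaining classes and the
  Born-infinite rest, for the planner's variant B.

No `sorry`, no new definitions; the open statements enter only as hypotheses.
References: KennedyLiebShastry1988; ReedSimonIV1978 Thm XIII.1–2, §XIII.12; BoccatoEtAl2019Acta Thm 1.1; LSSY2005 §1.2, Ch. 5.
-/

noncomputable section

open MeasureTheory Filter
open scoped ENNReal NNReal

namespace Summit.AtomisticToContinuum.BoseEinsteinCondensation.Cruxes.GDTransfer.Seeded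

open Literature.MathematicalPhysics.QuantumManyBody.BoseGas
open Summit.AtomisticToContinuum.BoseEinsteinCondensation.Theses.BECThomsonPrinciple
open Summit.AtomisticToContinuum.BoseEinsteinCondensation.Cruxes.GDTransfer.DysonDressedWitness
  (PeriodicBECFor gdTransfer_iff)

/-- **The seed at a finite continuous potential from a Ky Fan gap floor** (the spectral-seed programme discharged of its four
analytic sub-goals). -/
theorem noBalancedCatFor_of_kyFanGapFloor (v : ℝ → ℝ≥0∞) (hv : IsRepulsiveFiniteRange v) (hfc : IsFiniteContinuous v)
    (hgap : KyFanGapFloorFor v) : NoBalancedCatFor v :=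
  seedFor_of_kyFanGapFloor smoothBlockAlgebra smoothSplitting pinchingBound catKyFan v hv hfc hgap

/-- **Gaussian domination + Ky Fan gap floor ⇒ periodic BEC, finite continuous pair potentials** (registered glue of the spectral
programme): the per-potential connectedness assembly `ivtGlue_for` over the landed count law, the spectral seed, band emptiness from
Gaussian domination (`gd_bandEmptiness`), the free corner and local constancy for finite continuous profiles. -/
theorem periodicBEC_of_gd_of_kyFanGapFloor : Summit.AtomisticToContinuum.BoseEinsteinCondensation.Theses.BECThomsonPrinciple.GaussianDominationCan → ∀ v : ℝ → ℝ≥0∞, IsRepulsiveFiniteRange v → IsFiniteContinuous v → KyFanGapFloorFor v → PeriodicBECFor v :=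
  fun hG v hv hfc hgap => ivtGlue_for stub_countLaw v hv (noBalancedCatFor_of_kyFanGapFloor v hv hfc hgap)
    (gd_bandEmptiness hG v hv hfc) (stub_freeCorner v hv) (stub_localConstancy stub_countLaw v hv hfc)

/-- Variant B of the split, glue: the crux from (i) Ky Fan gap floors for finite continuous potentials, (ii) the seed at every other
admissible potential, (iii) the Born-infinite rest. -/
theorem gdTransfer_of_kyFanGapFloor_of_rest
    (hgap : ∀ v : ℝ → ℝ≥0∞, IsRepulsiveFiniteRange v → IsFiniteContinuous v → KyFanGapFloorFor v)
    (hseed : ∀ v : ℝ → ℝ≥0∞, IsRepulsiveFiniteRange v → ¬ IsFiniteContinuous v → NoBalancedCatFor v)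
    (hRest : Sig.stub_nonIntegrableRest) : GDTransfer := by
  refine GDTransfer_of_seed_of_nonIntegrableRest (noBalancedCat_of_forall fun v hv => ?_) hRest
  by_cases hfc : IsFiniteContinuous v
  · exact noBalancedCatFor_of_kyFanGapFloor v hv hfc (hgap v hv hfc)
  · exact hseed v hv hfc

end Summit.AtomisticToContinuum.BoseEinsteinCondensation.Cruxes.GDTransfer.Seeded

end
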